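/-
Copyright (c) 2026. All rights reserved.
Released under Apache 2.0 license as described in the file LICENSE.
Authors: abc-iut cell, prover seat abc-iut-E-t42 (gen 7).
-/
import Mathlib.NumberTheory.NumberField.Discriminant.Defs
import Mathlib.NumberTheory.NumberField.Norm
import Mathlib.NumberTheory.NumberField.InfinitePlace.Basic
import HarnessLib

/-!
# The four conjugates of an algebraic integer in a quartic number field: symmetric functions, power sums, discriminant

Classical algebra (nothing disputed; no definition, no `Prop` fact, no instance).  For a number field `K` with
`[K:ℚ] = 4`, an enumeration `e : (K →+* ℂ) ≃ Fin 4` of its complex embeddings and an algebraic integer `a ∈ 𝓞 K`,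
write `z_i = e⁻¹(i)(a)` for the four conjugates.  This file records, in kernel-usable form and WITHOUT introducing the
minimal polynomial, the data Hunter-type enumerations of small-discriminant fields run on:

* §1 identities for four complex numbers: Vieta (`∏ (t − z_i) = t⁴ − e₁t³ + e₂t² − e₃t + e₄`), Newton for `e₂`, `e₃`,
  the root relation `z_i⁴ = e₁z_i³ − e₂z_i² + e₃z_i − e₄` and the power-sum recurrence;
* §2 `trace_int_cast_eq_sum` / `norm_int_cast_eq_prod` — `Tr(a^k) = ∑ z_i^k`, `N(a) = ∏ z_i` (Mathlib's
  `trace_eq_sum_embeddings` / `norm_eq_prod_embeddings` re-indexed by `Fin 4`);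
* §3 **`exists_int_eq_esymm_two` / `exists_int_eq_esymm_three`** — the elementary symmetric functions `e₂(z)`, `e₃(z)`
  are (casts of) INTEGERS (integral over `ℤ` and rational by Newton; `ℤ` integrally closed), so the characteristic
  polynomial `X⁴ − s₁X³ + s₂X² − s₃X + s₄` of `a` has integer coefficients `s₁ = Tr a`, `s₄ = N a`;
* §4 `conj_isRoot` / `eq_conj_of_isRoot` — every conjugate is a root of that quartic and every complex root is a conjugate;
  `aeval_self_eq_zero` — `a` itself is a root in `K`;
* §5 **`hankel_traces_det_eq_sq_mul_discr`** — the `4 × 4` Hankel determinant of the traces `Tr(a^{i+j})`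
  (`= discr ℚ (1, a, a², a³)`) equals `m² · d_K` for an integer `m` (Mathlib `Algebra.discr_of_matrix_mulVec` against
  the integral basis): the discriminant of the characteristic polynomial is `d_K` times a square.

[cite: EsmondeMurty1999, Ex. 6.5.12 and Ex. 6.5.21 p. 93]
-/

namespace Literature.NumberTheory.NumberFields

open NumberField Module Finset
open scoped Matrix

/-! ## §1. Four complex numbers -/

section FourNumbers

variable {R : Type*} [CommRing R] (t z₀ z₁ z₂ z₃ : R)

/-- Vieta for four roots: `∏ (t − zᵢ) = t⁴ − e₁t³ + e₂t² − e₃t + e₄`. [cite: NeukirchANT1999, Ch. I §2, (2.2)–(2.9)] -/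
theorem quartic_vieta :
    (t - z₀) * (t - z₁) * (t - z₂) * (t - z₃) =
      t ^ 4 - (z₀ + z₁ + z₂ + z₃) * t ^ 3
        + (z₀ * z₁ + z₀ * z₂ + z₀ * z₃ + z₁ * z₂ + z₁ * z₃ + z₂ * z₃) * t ^ 2
        - (z₀ * z₁ * z₂ + z₀ * z₁ * z₃ + z₀ * z₂ * z₃ + z₁ * z₂ * z₃) * t + z₀ * z₁ * z₂ * z₃ := by
  ring

/-- Newton for `e₂`: `2e₂ = p₁² − p₂`. [cite: NeukirchANT1999, Ch. I §2, (2.2)–(2.9)] -/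
theorem quartic_newton_two :
    2 * (z₀ * z₁ + z₀ * z₂ + z₀ * z₃ + z₁ * z₂ + z₁ * z₃ + z₂ * z₃) =
      (z₀ + z₁ + z₂ + z₃) ^ 2 - (z₀ ^ 2 + z₁ ^ 2 + z₂ ^ 2 + z₃ ^ 2) := by
  ring

/-- Newton for `e₃`: `6e₃ = p₁³ − 3p₁p₂ + 2p₃`. [cite: NeukirchANT1999, Ch. I §2, (2.2)–(2.9)] -/
theorem quartic_newton_three :
    6 * (z₀ * z₁ * z₂ + z₀ * z₁ * z₃ + z₀ * z₂ * z₃ + z₁ * z₂ * z₃) =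
      (z₀ + z₁ + z₂ + z₃) ^ 3 - 3 * (z₀ + z₁ + z₂ + z₃) * (z₀ ^ 2 + z₁ ^ 2 + z₂ ^ 2 + z₃ ^ 2)
        + 2 * (z₀ ^ 3 + z₁ ^ 3 + z₂ ^ 3 + z₃ ^ 3) := by
  ring

/-- Newton for `e₄`: `24e₄ = p₁⁴ − 6p₁²p₂ + 3p₂² + 8p₁p₃ − 6p₄`. [cite: NeukirchANT1999, Ch. I §2, (2.2)–(2.9)] -/
theorem quartic_newton_four :
    24 * (z₀ * z₁ * z₂ * z₃) =
      (z₀ + z₁ + z₂ + z₃) ^ 4 - 6 * (z₀ + z₁ + z₂ + z₃) ^ 2 * (z₀ ^ 2 + z₁ ^ 2 + z₂ ^ 2 + z₃ ^ 2)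
        + 3 * (z₀ ^ 2 + z₁ ^ 2 + z₂ ^ 2 + z₃ ^ 2) ^ 2
        + 8 * (z₀ + z₁ + z₂ + z₃) * (z₀ ^ 3 + z₁ ^ 3 + z₂ ^ 3 + z₃ ^ 3)
        - 6 * (z₀ ^ 4 + z₁ ^ 4 + z₂ ^ 4 + z₃ ^ 4) := by
  ring

end FourNumbers

/-! ## §2. The conjugates of an element of a quartic field, indexed by `Fin 4` -/

section Quartic

variable {K : Type*} [Field K] [NumberField K] (e : (K →+* ℂ) ≃ Fin 4)

/-- A sum over the complex embeddings, re-indexed by `Fin 4`. [cite: NeukirchANT1999, Ch. I §2, (2.2)–(2.9)] -/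
theorem sum_embeddings_eq_sum_fin {M : Type*} [AddCommMonoid M] (f : (K →+* ℂ) → M) :
    ∑ σ : K →+* ℂ, f σ = f (e.symm 0) + f (e.symm 1) + f (e.symm 2) + f (e.symm 3) := by
  rw [← e.symm.sum_comp, Fin.sum_univ_four]

/-- A product over the complex embeddings, re-indexed by `Fin 4`. [cite: NeukirchANT1999, Ch. I §2, (2.2)–(2.9)] -/
theorem prod_embeddings_eq_prod_fin {M : Type*} [CommMonoid M] (f : (K →+* ℂ) → M) :
    ∏ σ : K →+* ℂ, f σ = f (e.symm 0) * f (e.symm 1) * f (e.symm 2) * f (e.symm 3) := by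
  rw [← e.symm.prod_comp, Fin.prod_univ_four]

/-- `Tr_{K/ℚ}(x) = ∑_σ σ(x)` over the ring-hom embeddings `K →+* ℂ`. [cite: NeukirchANT1999, Ch. I §2, (2.2)–(2.9)] -/
theorem trace_rat_cast_eq_sum_embeddings (x : K) :
    ((Algebra.trace ℚ K x : ℚ) : ℂ) = ∑ σ : K →+* ℂ, σ x := by
  have h := trace_eq_sum_embeddings ℂ (K := ℚ) (L := K) (x := x)
  rw [Fintype.sum_equiv RingHom.equivRatAlgHom (fun σ : K →+* ℂ => σ x) (fun σ : K →ₐ[ℚ] ℂ => σ x)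
    (fun σ => rfl), ← h]
  rfl

/-- `N_{K/ℚ}(x) = ∏_σ σ(x)` over the ring-hom embeddings `K →+* ℂ`. [cite: NeukirchANT1999, Ch. I §2, (2.2)–(2.9)] -/
theorem norm_rat_cast_eq_prod_embeddings (x : K) :
    ((Algebra.norm ℚ x : ℚ) : ℂ) = ∏ σ : K →+* ℂ, σ x := by
  have h := Algebra.norm_eq_prod_embeddings ℚ ℂ x
  rw [Fintype.prod_equiv RingHom.equivRatAlgHom (fun σ : K →+* ℂ => σ x) (fun σ : K →ₐ[ℚ] ℂ => σ x)
    (fun σ => rfl), ← h]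
  rfl

/-- **`Tr(x) = z₀ + z₁ + z₂ + z₃`** for an algebraic integer `x`, with the `ℤ`-valued trace. [cite: NeukirchANT1999, Ch. I §2, (2.2)–(2.9)] -/
theorem trace_int_cast_eq_sum (x : 𝓞 K) :
    ((Algebra.trace ℤ (𝓞 K) x : ℤ) : ℂ) =
      (e.symm 0) x + (e.symm 1) x + (e.symm 2) x + (e.symm 3) x := by
  have h1 : ((Algebra.trace ℤ (𝓞 K) x : ℤ) : ℂ) = ((Algebra.trace ℚ K (x : K) : ℚ) : ℂ) := by
    rw [← Algebra.coe_trace_int]; norm_cast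
  rw [h1, trace_rat_cast_eq_sum_embeddings, sum_embeddings_eq_sum_fin e]

/-- **`Tr(x^k) = ∑ zᵢ^k`**: the power sums of the conjugates are the traces of the powers. [cite: NeukirchANT1999, Ch. I §2, (2.2)–(2.9)] -/
theorem trace_int_pow_cast_eq_sum (x : 𝓞 K) (k : ℕ) :
    ((Algebra.trace ℤ (𝓞 K) (x ^ k) : ℤ) : ℂ) =
      (e.symm 0) x ^ k + (e.symm 1) x ^ k + (e.symm 2) x ^ k + (e.symm 3) x ^ k := by
  rw [trace_int_cast_eq_sum e]
  simp

/-- **`N(x) = z₀ z₁ z₂ z₃`** for an algebraic integer `x`, with the `ℤ`-valued norm. [cite: NeukirchANT1999, Ch. I §2, (2.2)–(2.9)] -/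
theorem norm_int_cast_eq_prod (x : 𝓞 K) :
    ((Algebra.norm ℤ x : ℤ) : ℂ) = (e.symm 0) x * (e.symm 1) x * (e.symm 2) x * (e.symm 3) x := by
  have h1 : ((Algebra.norm ℤ x : ℤ) : ℂ) = ((Algebra.norm ℚ (x : K) : ℚ) : ℂ) := by
    rw [← Algebra.coe_norm_int]; norm_cast
  rw [h1, norm_rat_cast_eq_prod_embeddings, prod_embeddings_eq_prod_fin e]

/-- `∑_σ ‖σ x‖ = ‖z₀‖ + ‖z₁‖ + ‖z₂‖ + ‖z₃‖`. [cite: NeukirchANT1999, Ch. I §2, (2.2)–(2.9)] -/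
theorem sum_norm_embeddings_eq_sum (x : K) :
    ∑ σ : K →+* ℂ, ‖σ x‖ = ‖(e.symm 0) x‖ + ‖(e.symm 1) x‖ + ‖(e.symm 2) x‖ + ‖(e.symm 3) x‖ :=
  sum_embeddings_eq_sum_fin e _

/-- `|N(x)| = ‖z₀‖ ‖z₁‖ ‖z₂‖ ‖z₃‖` for an algebraic integer `x`. [cite: NeukirchANT1999, Ch. I §2, (2.2)–(2.9)] -/
theorem abs_norm_int_cast_eq_prod_norm (x : 𝓞 K) :
    (|(Algebra.norm ℤ x : ℤ)| : ℝ) = ‖(e.symm 0) x‖ * ‖(e.symm 1) x‖ * ‖(e.symm 2) x‖ * ‖(e.symm 3) x‖ := by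
  have h := congr_arg (‖·‖) (norm_int_cast_eq_prod e x)
  simp only [norm_mul, Complex.norm_intCast] at h
  exact h

/-! ## §3. Integrality of the elementary symmetric functions -/

omit [NumberField K] in
/-- Each conjugate of an algebraic integer is integral over `ℤ`. [cite: NeukirchANT1999, Ch. I §2, (2.2)–(2.9)] -/
theorem isIntegral_conj (σ : K →+* ℂ) (x : 𝓞 K) : IsIntegral ℤ (σ x) :=
  map_isIntegral_int σ (RingOfIntegers.isIntegral_coe x)

/-- A complex number that is integral over `ℤ` and equal to (the cast of) a rational is (the cast of) an integer.
[cite: NeukirchANT1999, Ch. I §2, (2.2)–(2.9)] -/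
theorem exists_int_cast_eq_of_isIntegral_of_eq_ratCast {w : ℂ} (hw : IsIntegral ℤ w) {q : ℚ} (hq : w = (q : ℂ)) :
    ∃ m : ℤ, (m : ℂ) = w := by
  subst hq
  have h1 : IsIntegral ℤ q := by
    have : (q : ℂ) = algebraMap ℚ ℂ q := rfl
    rw [this] at hw
    exact (isIntegral_algebraMap_iff (algebraMap ℚ ℂ).injective).mp hw
  obtain ⟨m, hm⟩ := IsIntegrallyClosed.isIntegral_iff.mp h1
  refine ⟨m, ?_⟩
  rw [← hm]
  simp

/-- **`e₂` of the conjugates is an integer**: `∃ s₂ ∈ ℤ`, `s₂ = ∑_{i<j} zᵢ zⱼ`. [cite: NeukirchANT1999, Ch. I §2, (2.2)–(2.9)] -/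
theorem exists_int_eq_esymm_two (x : 𝓞 K) :
    ∃ s₂ : ℤ, (s₂ : ℂ) =
      (e.symm 0) x * (e.symm 1) x + (e.symm 0) x * (e.symm 2) x + (e.symm 0) x * (e.symm 3) x
        + (e.symm 1) x * (e.symm 2) x + (e.symm 1) x * (e.symm 3) x + (e.symm 2) x * (e.symm 3) x := by
  have hint : IsIntegral ℤ ((e.symm 0) x * (e.symm 1) x + (e.symm 0) x * (e.symm 2) x + (e.symm 0) x * (e.symm 3) x
        + (e.symm 1) x * (e.symm 2) x + (e.symm 1) x * (e.symm 3) x + (e.symm 2) x * (e.symm 3) x) := by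
    have h0 := isIntegral_conj (e.symm 0) x; have h1 := isIntegral_conj (e.symm 1) x
    have h2 := isIntegral_conj (e.symm 2) x; have h3 := isIntegral_conj (e.symm 3) x
    apply_rules [IsIntegral.add, IsIntegral.mul]
  have h2 : (2 : ℂ) * ((e.symm 0) x * (e.symm 1) x + (e.symm 0) x * (e.symm 2) x + (e.symm 0) x * (e.symm 3) x
        + (e.symm 1) x * (e.symm 2) x + (e.symm 1) x * (e.symm 3) x + (e.symm 2) x * (e.symm 3) x)
      = ((Algebra.trace ℤ (𝓞 K) x ^ 2 - Algebra.trace ℤ (𝓞 K) (x ^ 2) : ℤ) : ℂ) := by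
    push_cast
    rw [trace_int_pow_cast_eq_sum e, trace_int_cast_eq_sum e]
    ring
  have hq : ((e.symm 0) x * (e.symm 1) x + (e.symm 0) x * (e.symm 2) x + (e.symm 0) x * (e.symm 3) x
        + (e.symm 1) x * (e.symm 2) x + (e.symm 1) x * (e.symm 3) x + (e.symm 2) x * (e.symm 3) x)
      = ((((Algebra.trace ℤ (𝓞 K) x ^ 2 - Algebra.trace ℤ (𝓞 K) (x ^ 2) : ℤ) : ℚ) / 2 : ℚ) : ℂ) := by
    push_cast at h2 ⊢
    linear_combination h2 / 2
  exact exists_int_cast_eq_of_isIntegral_of_eq_ratCast hint hq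

/-- **`e₃` of the conjugates is an integer**: `∃ s₃ ∈ ℤ`, `s₃ = ∑_{i<j<k} zᵢ zⱼ z_k`. [cite: NeukirchANT1999, Ch. I §2, (2.2)–(2.9)] -/
theorem exists_int_eq_esymm_three (x : 𝓞 K) :
    ∃ s₃ : ℤ, (s₃ : ℂ) =
      (e.symm 0) x * (e.symm 1) x * (e.symm 2) x + (e.symm 0) x * (e.symm 1) x * (e.symm 3) x
        + (e.symm 0) x * (e.symm 2) x * (e.symm 3) x + (e.symm 1) x * (e.symm 2) x * (e.symm 3) x := by
  have hint : IsIntegral ℤ ((e.symm 0) x * (e.symm 1) x * (e.symm 2) x + (e.symm 0) x * (e.symm 1) x * (e.symm 3) x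
        + (e.symm 0) x * (e.symm 2) x * (e.symm 3) x + (e.symm 1) x * (e.symm 2) x * (e.symm 3) x) := by
    have h0 := isIntegral_conj (e.symm 0) x; have h1 := isIntegral_conj (e.symm 1) x
    have h2 := isIntegral_conj (e.symm 2) x; have h3 := isIntegral_conj (e.symm 3) x
    apply_rules [IsIntegral.add, IsIntegral.mul]
  have h6 : (6 : ℂ) * ((e.symm 0) x * (e.symm 1) x * (e.symm 2) x + (e.symm 0) x * (e.symm 1) x * (e.symm 3) x
        + (e.symm 0) x * (e.symm 2) x * (e.symm 3) x + (e.symm 1) x * (e.symm 2) x * (e.symm 3) x)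
      = ((Algebra.trace ℤ (𝓞 K) x ^ 3 - 3 * Algebra.trace ℤ (𝓞 K) x * Algebra.trace ℤ (𝓞 K) (x ^ 2)
          + 2 * Algebra.trace ℤ (𝓞 K) (x ^ 3) : ℤ) : ℂ) := by
    push_cast
    rw [trace_int_pow_cast_eq_sum e, trace_int_pow_cast_eq_sum e, trace_int_cast_eq_sum e]
    ring
  have hq : ((e.symm 0) x * (e.symm 1) x * (e.symm 2) x + (e.symm 0) x * (e.symm 1) x * (e.symm 3) x
        + (e.symm 0) x * (e.symm 2) x * (e.symm 3) x + (e.symm 1) x * (e.symm 2) x * (e.symm 3) x)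
      = ((((Algebra.trace ℤ (𝓞 K) x ^ 3 - 3 * Algebra.trace ℤ (𝓞 K) x * Algebra.trace ℤ (𝓞 K) (x ^ 2)
          + 2 * Algebra.trace ℤ (𝓞 K) (x ^ 3) : ℤ) : ℚ) / 6 : ℚ) : ℂ) := by
    push_cast at h6 ⊢
    linear_combination h6 / 6
  exact exists_int_cast_eq_of_isIntegral_of_eq_ratCast hint hq

/-- **The integer characteristic data of `x`**: integers `s₁ = Tr x`, `s₂`, `s₃`, `s₄ = N x` whose casts are the four
elementary symmetric functions of the conjugates. [cite: NeukirchANT1999, Ch. I §2, (2.2)–(2.9)] -/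
theorem exists_int_charData (x : 𝓞 K) :
    ∃ s₁ s₂ s₃ s₄ : ℤ, s₁ = Algebra.trace ℤ (𝓞 K) x ∧ s₄ = Algebra.norm ℤ x ∧
      (s₁ : ℂ) = (e.symm 0) x + (e.symm 1) x + (e.symm 2) x + (e.symm 3) x ∧
      (s₂ : ℂ) = (e.symm 0) x * (e.symm 1) x + (e.symm 0) x * (e.symm 2) x + (e.symm 0) x * (e.symm 3) x
        + (e.symm 1) x * (e.symm 2) x + (e.symm 1) x * (e.symm 3) x + (e.symm 2) x * (e.symm 3) x ∧
      (s₃ : ℂ) = (e.symm 0) x * (e.symm 1) x * (e.symm 2) x + (e.symm 0) x * (e.symm 1) x * (e.symm 3) x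
        + (e.symm 0) x * (e.symm 2) x * (e.symm 3) x + (e.symm 1) x * (e.symm 2) x * (e.symm 3) x ∧
      (s₄ : ℂ) = (e.symm 0) x * (e.symm 1) x * (e.symm 2) x * (e.symm 3) x := by
  obtain ⟨s₂, h₂⟩ := exists_int_eq_esymm_two e x
  obtain ⟨s₃, h₃⟩ := exists_int_eq_esymm_three e x
  exact ⟨_, s₂, s₃, _, rfl, rfl, trace_int_cast_eq_sum e x, h₂, h₃, norm_int_cast_eq_prod e x⟩

/-! ## §4. Roots -/

variable {e}

omit [NumberField K] in
/-- Every conjugate `zᵢ` is a root of `t⁴ − s₁t³ + s₂t² − s₃t + s₄` (over `ℂ`). [cite: NeukirchANT1999, Ch. I §2, (2.2)–(2.9)] -/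
theorem conj_isRoot {x : 𝓞 K} {s₁ s₂ s₃ s₄ : ℤ}
    (h₁ : (s₁ : ℂ) = (e.symm 0) x + (e.symm 1) x + (e.symm 2) x + (e.symm 3) x)
    (h₂ : (s₂ : ℂ) = (e.symm 0) x * (e.symm 1) x + (e.symm 0) x * (e.symm 2) x + (e.symm 0) x * (e.symm 3) x
        + (e.symm 1) x * (e.symm 2) x + (e.symm 1) x * (e.symm 3) x + (e.symm 2) x * (e.symm 3) x)
    (h₃ : (s₃ : ℂ) = (e.symm 0) x * (e.symm 1) x * (e.symm 2) x + (e.symm 0) x * (e.symm 1) x * (e.symm 3) x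
        + (e.symm 0) x * (e.symm 2) x * (e.symm 3) x + (e.symm 1) x * (e.symm 2) x * (e.symm 3) x)
    (h₄ : (s₄ : ℂ) = (e.symm 0) x * (e.symm 1) x * (e.symm 2) x * (e.symm 3) x) (i : Fin 4) :
    ((e.symm i) x) ^ 4 - s₁ * ((e.symm i) x) ^ 3 + s₂ * ((e.symm i) x) ^ 2 - s₃ * (e.symm i) x + s₄ = 0 := by
  have key : ((e.symm i) x) ^ 4 - s₁ * ((e.symm i) x) ^ 3 + s₂ * ((e.symm i) x) ^ 2 - s₃ * (e.symm i) x + s₄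
      = ((e.symm i) x - (e.symm 0) x) * ((e.symm i) x - (e.symm 1) x) * ((e.symm i) x - (e.symm 2) x)
        * ((e.symm i) x - (e.symm 3) x) := by
    rw [h₁, h₂, h₃, h₄]; ring
  rw [key]
  fin_cases i <;> simp

/-- `x` itself is a root of `t⁴ − s₁t³ + s₂t² − s₃t + s₄` in `𝓞 K`. [cite: NeukirchANT1999, Ch. I §2, (2.2)–(2.9)] -/
theorem self_isRoot {x : 𝓞 K} {s₁ s₂ s₃ s₄ : ℤ}
    (h₁ : (s₁ : ℂ) = (e.symm 0) x + (e.symm 1) x + (e.symm 2) x + (e.symm 3) x)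
    (h₂ : (s₂ : ℂ) = (e.symm 0) x * (e.symm 1) x + (e.symm 0) x * (e.symm 2) x + (e.symm 0) x * (e.symm 3) x
        + (e.symm 1) x * (e.symm 2) x + (e.symm 1) x * (e.symm 3) x + (e.symm 2) x * (e.symm 3) x)
    (h₃ : (s₃ : ℂ) = (e.symm 0) x * (e.symm 1) x * (e.symm 2) x + (e.symm 0) x * (e.symm 1) x * (e.symm 3) x
        + (e.symm 0) x * (e.symm 2) x * (e.symm 3) x + (e.symm 1) x * (e.symm 2) x * (e.symm 3) x)
    (h₄ : (s₄ : ℂ) = (e.symm 0) x * (e.symm 1) x * (e.symm 2) x * (e.symm 3) x) :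
    (x : K) ^ 4 - s₁ * (x : K) ^ 3 + s₂ * (x : K) ^ 2 - s₃ * (x : K) + s₄ = 0 := by
  apply (e.symm 0).injective
  have h := conj_isRoot h₁ h₂ h₃ h₄ 0
  simp only [map_sub, map_add, map_mul, map_pow, map_intCast, map_zero]
  exact h

omit [NumberField K] in
/-- **Every complex root of `t⁴ − s₁t³ + s₂t² − s₃t + s₄` is a conjugate of `x`.** [cite: NeukirchANT1999, Ch. I §2, (2.2)–(2.9)] -/
theorem eq_conj_of_isRoot {x : 𝓞 K} {s₁ s₂ s₃ s₄ : ℤ}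
    (h₁ : (s₁ : ℂ) = (e.symm 0) x + (e.symm 1) x + (e.symm 2) x + (e.symm 3) x)
    (h₂ : (s₂ : ℂ) = (e.symm 0) x * (e.symm 1) x + (e.symm 0) x * (e.symm 2) x + (e.symm 0) x * (e.symm 3) x
        + (e.symm 1) x * (e.symm 2) x + (e.symm 1) x * (e.symm 3) x + (e.symm 2) x * (e.symm 3) x)
    (h₃ : (s₃ : ℂ) = (e.symm 0) x * (e.symm 1) x * (e.symm 2) x + (e.symm 0) x * (e.symm 1) x * (e.symm 3) x
        + (e.symm 0) x * (e.symm 2) x * (e.symm 3) x + (e.symm 1) x * (e.symm 2) x * (e.symm 3) x)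
    (h₄ : (s₄ : ℂ) = (e.symm 0) x * (e.symm 1) x * (e.symm 2) x * (e.symm 3) x) {t : ℂ}
    (ht : t ^ 4 - s₁ * t ^ 3 + s₂ * t ^ 2 - s₃ * t + s₄ = 0) : ∃ i : Fin 4, t = (e.symm i) x := by
  have hv := quartic_vieta t ((e.symm 0) (x : K)) ((e.symm 1) (x : K)) ((e.symm 2) (x : K)) ((e.symm 3) (x : K))
  rw [← h₁, ← h₂, ← h₃, ← h₄, ht] at hv
  rcases mul_eq_zero.mp hv with h | h
  · rcases mul_eq_zero.mp h with h | h
    · rcases mul_eq_zero.mp h with h | h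
      · exact ⟨0, sub_eq_zero.mp h⟩
      · exact ⟨1, sub_eq_zero.mp h⟩
    · exact ⟨2, sub_eq_zero.mp h⟩
  · exact ⟨3, sub_eq_zero.mp h⟩

/-- A RATIONAL-INTEGER root forces `x ∈ ℤ`: if `r ∈ ℤ` is a root then `x = r` (some conjugate equals `r`, and the
embeddings are injective), so `N(x) = r⁴`. [cite: NeukirchANT1999, Ch. I §2, (2.2)–(2.9)] -/
theorem norm_eq_pow_four_of_int_isRoot {x : 𝓞 K} {s₁ s₂ s₃ s₄ : ℤ}
    (h₁ : (s₁ : ℂ) = (e.symm 0) x + (e.symm 1) x + (e.symm 2) x + (e.symm 3) x)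
    (h₂ : (s₂ : ℂ) = (e.symm 0) x * (e.symm 1) x + (e.symm 0) x * (e.symm 2) x + (e.symm 0) x * (e.symm 3) x
        + (e.symm 1) x * (e.symm 2) x + (e.symm 1) x * (e.symm 3) x + (e.symm 2) x * (e.symm 3) x)
    (h₃ : (s₃ : ℂ) = (e.symm 0) x * (e.symm 1) x * (e.symm 2) x + (e.symm 0) x * (e.symm 1) x * (e.symm 3) x
        + (e.symm 0) x * (e.symm 2) x * (e.symm 3) x + (e.symm 1) x * (e.symm 2) x * (e.symm 3) x)
    (h₄ : (s₄ : ℂ) = (e.symm 0) x * (e.symm 1) x * (e.symm 2) x * (e.symm 3) x) {r : ℤ}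
    (hr : r ^ 4 - s₁ * r ^ 3 + s₂ * r ^ 2 - s₃ * r + s₄ = 0) : Algebra.norm ℤ x = r ^ 4 := by
  obtain ⟨i, hi⟩ := eq_conj_of_isRoot h₁ h₂ h₃ h₄ (t := (r : ℂ)) (by exact_mod_cast hr)
  have hx : (x : K) = (r : K) := by
    apply (e.symm i).injective
    rw [← hi, map_intCast]
  have key : ((Algebra.norm ℤ x : ℤ) : ℂ) = ((r ^ 4 : ℤ) : ℂ) := by
    rw [norm_int_cast_eq_prod e, hx]
    simp; ring
  exact_mod_cast key

/-- A QUADRATIC integer factor yields a square root: if `x` is a root of `t² + ut + v` (`u v ∈ ℤ`) then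
`(2x + u)² = u² − 4v`. [cite: NeukirchANT1999, Ch. I §2, (2.2)–(2.9)] -/
theorem sq_eq_of_quadratic_root {L : Type*} [CommRing L] {y : L} {u v : ℤ} (h : y ^ 2 + u * y + v = 0) :
    (2 * y + u) ^ 2 = ((u ^ 2 - 4 * v : ℤ) : L) := by
  push_cast
  linear_combination 4 * h

end Quartic

/-! ## §5. The Hankel determinant of traces is `m² · d_K` -/

section Hankel

variable {K : Type*} [Field K] [NumberField K]

/-- The trace matrix of `(1, a, a², a³)` has entries `Tr(a^{i+j})`. [cite: NeukirchANT1999, Ch. I §2, (2.2)–(2.9)] -/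
theorem traceMatrix_powers_apply (a : K) (i j : Fin 4) :
    Algebra.traceMatrix ℚ (fun k : Fin 4 => a ^ (k : ℕ)) i j = Algebra.trace ℚ K (a ^ ((i : ℕ) + (j : ℕ))) := by
  rw [Algebra.traceMatrix_apply, Algebra.traceForm_apply, ← pow_add]

/-- **`discr ℚ (1, a, a², a³) = m² · d_K`** for an algebraic integer `a` of a quartic field: the powers of `a` are an
integer combination of an integral basis, and `Algebra.discr_of_matrix_mulVec`. [cite: NeukirchANT1999, Ch. I §2, (2.2)–(2.9)] -/
theorem exists_discr_powers_eq_sq_mul_discr (h4 : finrank ℚ K = 4) (a : 𝓞 K) :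
    ∃ m : ℤ, Algebra.discr ℚ (fun k : Fin 4 => (a : K) ^ (k : ℕ)) = (m : ℚ) ^ 2 * NumberField.discr K := by
  classical
  let ι := Free.ChooseBasisIndex ℤ (𝓞 K)
  have hcard : Fintype.card ι = 4 := by
    rw [← finrank_eq_card_chooseBasisIndex, RingOfIntegers.rank, h4]
  let f : ι ≃ Fin 4 := Fintype.equivFinOfCardEq hcard
  let bI : Basis (Fin 4) ℤ (𝓞 K) := (RingOfIntegers.basis K).reindex f
  let P : Matrix (Fin 4) (Fin 4) ℤ := Matrix.of fun i j => bI.repr (a ^ (i : ℕ)) j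
  let P' : Matrix (Fin 4) (Fin 4) ℚ := P.map (Int.castRingHom ℚ)
  have hP : (P'.map (algebraMap ℚ K)) *ᵥ (fun j : Fin 4 => ((bI j : 𝓞 K) : K)) = fun k : Fin 4 => (a : K) ^ (k : ℕ) := by
    funext i
    have hK : (algebraMap (𝓞 K) K) (a ^ (i : ℕ)) =
        ∑ j, (((bI.repr (a ^ (i : ℕ)) j : ℤ) : K)) * (algebraMap (𝓞 K) K) (bI j) := by
      conv_lhs => rw [← bI.sum_repr (a ^ (i : ℕ))]
      simp [map_sum, zsmul_eq_mul]
    have ha : (a : K) ^ (i : ℕ) = (algebraMap (𝓞 K) K) (a ^ (i : ℕ)) := by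
      rw [map_pow]
    rw [ha, hK]
    simp only [Matrix.mulVec, dotProduct]
    refine Finset.sum_congr rfl fun j _ => ?_
    simp [P', P, Matrix.map_apply, Matrix.of_apply]
  have hdisc := Algebra.discr_of_matrix_mulVec (A := ℚ) (B := K) (fun j : Fin 4 => ((bI j : 𝓞 K) : K)) P'
  rw [hP] at hdisc
  have hbI : Algebra.discr ℚ (fun j : Fin 4 => ((bI j : 𝓞 K) : K)) = NumberField.discr K := by
    have h1 : (fun j : Fin 4 => ((bI j : 𝓞 K) : K)) = ⇑(integralBasis K) ∘ ⇑f.symm := by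
      funext j
      simp [bI, integralBasis_apply]
    rw [h1, Algebra.discr_reindex, coe_discr]
  refine ⟨P.det, ?_⟩
  rw [hdisc, hbI]
  congr 1
  simp only [P']
  rw [← RingHom.mapMatrix_apply, ← RingHom.map_det]
  simp

/-- **The Hankel determinant of the integer traces `Tr(a^{i+j})` (`0 ≤ i, j ≤ 3`) is `m² · d_K`.** [cite: NeukirchANT1999, Ch. I §2, (2.2)–(2.9)] -/
theorem hankel_traces_det_eq_sq_mul_discr (h4 : finrank ℚ K = 4) (a : 𝓞 K) :
    ∃ m : ℤ, (Matrix.of fun i j : Fin 4 => Algebra.trace ℤ (𝓞 K) (a ^ ((i : ℕ) + (j : ℕ)))).det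
      = m ^ 2 * NumberField.discr K := by
  obtain ⟨m, hm⟩ := exists_discr_powers_eq_sq_mul_discr h4 a
  refine ⟨m, ?_⟩
  have hmat : (Matrix.of fun i j : Fin 4 => Algebra.trace ℤ (𝓞 K) (a ^ ((i : ℕ) + (j : ℕ)))).map (Int.castRingHom ℚ)
      = Algebra.traceMatrix ℚ (fun k : Fin 4 => (a : K) ^ (k : ℕ)) := by
    ext i j
    rw [traceMatrix_powers_apply, Matrix.map_apply, Matrix.of_apply, eq_intCast, Algebra.coe_trace_int]
    simp
  have key : (((Matrix.of fun i j : Fin 4 => Algebra.trace ℤ (𝓞 K) (a ^ ((i : ℕ) + (j : ℕ)))).det : ℤ) : ℚ)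
      = ((m ^ 2 * NumberField.discr K : ℤ) : ℚ) := by
    rw [Int.cast_mul, Int.cast_pow, ← hm, Algebra.discr_def, ← hmat, ← RingHom.mapMatrix_apply,
      ← RingHom.map_det]
    simp
  exact_mod_cast key

end Hankel

end Literature.NumberTheory.NumberFields
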